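import Literature.NumberTheory.LFunctions.WeilTwoPrimeOddMarginHBase
import Literature.NumberTheory.LFunctions.WeilTwoPrimeOddMarginHDataP22
import Literature.NumberTheory.LFunctions.WeilBlockRowsP
import HarnessLib

/-!
# Two-prime odd-margin certificate H: the materialized block agrees with `P_r`, rows 110–119

`WeilCert.checkPmRow` (row `k` of the claim `Pm_{kl} = P_r(2k+1, 2l+1)`) for certificate H, by `decide +kernel`. Pure proof file; nothing is asserted.
-/

noncomputable section

namespace Literature.NumberTheory.LFunctions

set_option maxHeartbeats 0 in
/-- Row 110 of the materialized block is row 110 of `P_r` (certificate H). [folklore] -/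
theorem checkPmRow1_110_weilCert23H : weilCert23HBase.checkPmRow weilCert23HNu weilCert23HPm 1 110 = true := by
  decide +kernel

set_option maxHeartbeats 0 in
/-- Row 111 of the materialized block is row 111 of `P_r` (certificate H). [folklore] -/
theorem checkPmRow1_111_weilCert23H : weilCert23HBase.checkPmRow weilCert23HNu weilCert23HPm 1 111 = true := by
  decide +kernel

set_option maxHeartbeats 0 in
/-- Row 112 of the materialized block is row 112 of `P_r` (certificate H). [folklore] -/
theorem checkPmRow1_112_weilCert23H : weilCert23HBase.checkPmRow weilCert23HNu weilCert23HPm 1 112 = true := by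
  decide +kernel

set_option maxHeartbeats 0 in
/-- Row 113 of the materialized block is row 113 of `P_r` (certificate H). [folklore] -/
theorem checkPmRow1_113_weilCert23H : weilCert23HBase.checkPmRow weilCert23HNu weilCert23HPm 1 113 = true := by
  decide +kernel

set_option maxHeartbeats 0 in
/-- Row 114 of the materialized block is row 114 of `P_r` (certificate H). [folklore] -/
theorem checkPmRow1_114_weilCert23H : weilCert23HBase.checkPmRow weilCert23HNu weilCert23HPm 1 114 = true := by
  decide +kernel

set_option maxHeartbeats 0 in
/-- Row 115 of the materialized block is row 115 of `P_r` (certificate H). [folklore] -/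
theorem checkPmRow1_115_weilCert23H : weilCert23HBase.checkPmRow weilCert23HNu weilCert23HPm 1 115 = true := by
  decide +kernel

set_option maxHeartbeats 0 in
/-- Row 116 of the materialized block is row 116 of `P_r` (certificate H). [folklore] -/
theorem checkPmRow1_116_weilCert23H : weilCert23HBase.checkPmRow weilCert23HNu weilCert23HPm 1 116 = true := by
  decide +kernel

set_option maxHeartbeats 0 in
/-- Row 117 of the materialized block is row 117 of `P_r` (certificate H). [folklore] -/
theorem checkPmRow1_117_weilCert23H : weilCert23HBase.checkPmRow weilCert23HNu weilCert23HPm 1 117 = true := by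
  decide +kernel

set_option maxHeartbeats 0 in
/-- Row 118 of the materialized block is row 118 of `P_r` (certificate H). [folklore] -/
theorem checkPmRow1_118_weilCert23H : weilCert23HBase.checkPmRow weilCert23HNu weilCert23HPm 1 118 = true := by
  decide +kernel

set_option maxHeartbeats 0 in
/-- Row 119 of the materialized block is row 119 of `P_r` (certificate H). [folklore] -/
theorem checkPmRow1_119_weilCert23H : weilCert23HBase.checkPmRow weilCert23HNu weilCert23HPm 1 119 = true := by
  decide +kernel


end Literature.NumberTheory.LFunctions
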